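import Summits.AtomisticToContinuum.Crystallization.Theorems.SquareWellLayerCakeGapTwelveToBarlowUniformSpacingSelectionPartB
import Summits.AtomisticToContinuum.Crystallization.Theorems.SquareWellLayerCakeGapTwelveToBarlowUniformSpacingHullFaults
import Summits.AtomisticToContinuum.Crystallization.Theorems.SquareWellLayerCakeGapTwelveToBarlowUniformSpacingTransfer

/-!
# `stub_uniformSpacingSelection` (crux `GapTwelveToBarlow`, stmt-AtomisticToContinuum-15807), energetic side, III:
# at most `B₀(δ, K)` BAD BASE LAYERS per block of every layered hull element

The hull-level form of the energetic residual of `stub_uniformSpacing` (a.e. near-uniform gaps):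
for every `δ > 0` and `K : ℕ` there is `B₀ = B₀(δ, K)` such that for every sequence `x` of
Lennard-Jones ground states, every layered set `A(S(a, s, z))` in the hull of `x` and every block
`[m₁, m₁ + n)` of base layers, the number of base layers `m₀` of the block around which the heights are
NOT `δ`-close to an arithmetic progression on the layers `|m - m₀| ≤ K`,

  `¬ ∃ h, ∀ m, |m − m₀| ≤ K → |z m − z m₀ − (m − m₀) h| ≤ δ`,

is at most `B₀` — independently of `n`, of the block and of the hull element
(`hull_badLayers_le_of_landed`, anchor `stub_hullBadLayers`).  Assembly:

* part I (`hull_faultCount_le_of_landed`, landed): at most `F₀` stacking faults `s (m+1) ≠ -s m` in any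
  block of layers;
* part II (`hull_sqVariation_le_of_landed`): on a block without faults the squared variation
  `Σ (Δ m − Δ (m+1))²` of the increments `Δ m = z (m+1) − z m` is at most `O₀`;
* `sel_count_le` (Markov counting on the block split at its faults, induction on the number of faults):
  at most `(F + 1)·O₀/τ + F` positions `m` of a block with `F` faults have `(Δ m − Δ (m+1))² > τ`;
* `sel_nearArith_of_sqVar` (twice the landed `abs_sub_arith_le_of_increments`): if
  `(Δ m − Δ (m+1))² ≤ η²` for `|m − m₀| ≤ K` then the heights are `K² η`-close to the arithmetic
  progression `z m₀ + (m − m₀) Δ m₀` on `|m − m₀| ≤ K`;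

so with `η = δ/(K+1)²`, `τ = η²`, every bad base layer lies within `K` of a position of the enlarged
block `[m₁ − K, m₁ + n + K)` with `(Δ m − Δ (m+1))² > τ`, and `B₀ = (2K + 1)·((F₀ + 1)·O₀/τ + F₀)`.
What remains of `stub_uniformSpacingSelection` after this file is the passage hull ⇒ a.e. (a positive
density of bad sites along a subsequence forces a layered hull element with more than `B₀` bad base
layers in a block), see `uniformSpacingSelection-REPORT.md`.
-/

noncomputable section

namespace Summit.AtomisticToContinuum.Crystallization.Theorems.SquareWellLayerCakeGapTwelveToBarlow

open scoped BigOperators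
open Finset Filter Literature.MathematicalPhysics.StatisticalMechanics
open Summit.AtomisticToContinuum.Crystallization.Theorems.LayeredHull

/-! ## Near-arithmetic heights from small squared variation of the increments -/

/-- **Small increment variation ⇒ near-arithmetic heights.**  If `(Δ m − Δ (m+1))² ≤ η²` for all layers
`|m − m₀| ≤ K` (`Δ m = z (m+1) − z m`), then `|z m − z m₀ − (m − m₀) Δ m₀| ≤ K² η` for `|m − m₀| ≤ K`:
the increments are `K η`-close to `Δ m₀` (the landed `abs_sub_arith_le_of_increments` applied to `Δ`
with step `0`), hence the heights are `|m − m₀| K η`-close to arithmetic (the same lemma applied to `z`).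
[folklore] -/
theorem sel_nearArith_of_sqVar {z : ℤ → ℝ} {m₀ : ℤ} {K η : ℝ} (hK : 0 ≤ K) (hη : 0 ≤ η)
    (h : ∀ m : ℤ, |(m : ℝ) - m₀| ≤ K →
      ((z (m + 1) - z m) - (z (m + 2) - z (m + 1))) ^ 2 ≤ η ^ 2) :
    ∀ m : ℤ, |(m : ℝ) - m₀| ≤ K →
      |z m - z m₀ - ((m : ℝ) - m₀) * (z (m₀ + 1) - z m₀)| ≤ K ^ 2 * η := by
  -- the increments are `K η`-close to the base increment
  have hinc : ∀ m : ℤ, |(m : ℝ) - m₀| ≤ K → |z (m + 1) - z m - (z (m₀ + 1) - z m₀)| ≤ K * η := by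
    have H := abs_sub_arith_le_of_increments (z := fun m => z (m + 1) - z m) (m₀ := m₀) (K := K)
      (η := η) (h := 0) (fun m hm => by
        have h2 := abs_le_of_sq_le_sq (h m hm) hη
        show |z (m + 1 + 1) - z (m + 1) - (z (m + 1) - z m) - 0| ≤ η
        rw [sub_zero, abs_sub_comm]
        have e : m + 1 + 1 = m + 2 := by ring
        rw [e]
        exact h2)
    intro m hm
    have := H m hm
    rw [mul_zero, sub_zero] at this
    exact this.trans (mul_le_mul_of_nonneg_right hm hη)
  intro m hm
  have H := abs_sub_arith_le_of_increments (z := z) (m₀ := m₀) (K := K) (η := K * η)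
    (h := z (m₀ + 1) - z m₀) hinc m hm
  calc _ ≤ |(m : ℝ) - m₀| * (K * η) := H
    _ ≤ K * (K * η) := mul_le_mul_of_nonneg_right hm (by positivity)
    _ = K ^ 2 * η := by ring

/-! ## Markov counting on a block split at its faults -/

/-- **Counting.**  Let `V ≥ 0` on `ℤ` and suppose that on every integer interval `[p, q)` WITHOUT fault
`Σ_{[p,q)} V ≤ O₀` (`O₀ ≥ 0`).  Then on an interval `[p, q)` with at most `r` faults at most
`(r + 1)·O₀/τ + r` positions have `V > τ` (`τ > 0`): split at a fault and induct on `r`; on a fault-free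
interval this is Markov's inequality. [folklore] -/
theorem sel_count_le (fault : ℤ → Prop) [DecidablePred fault] (V : ℤ → ℝ) (hV : ∀ m, 0 ≤ V m)
    {O₀ τ : ℝ} (hO : 0 ≤ O₀) (hτ : 0 < τ)
    (hPB : ∀ p q : ℤ, (∀ m ∈ Finset.Ico p q, ¬fault m) → ∑ m ∈ Finset.Ico p q, V m ≤ O₀) :
    ∀ (r : ℕ) (p q : ℤ), ((Finset.Ico p q).filter fun m => fault m).card ≤ r →
      ((((Finset.Ico p q).filter fun m => τ < V m).card : ℕ) : ℝ) ≤ (r + 1) * (O₀ / τ) + r := by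
  intro r
  induction r using Nat.strong_induction_on with
  | _ r ih =>
  intro p q hr
  have h3 : 0 ≤ O₀ / τ := div_nonneg hO hτ.le
  by_cases h0 : ((Finset.Ico p q).filter fun m => fault m) = ∅
  · -- no fault in the interval: Markov's inequality
    have hnf : ∀ m ∈ Finset.Ico p q, ¬fault m := fun m hm => Finset.filter_eq_empty_iff.1 h0 hm
    have hmk : ((((Finset.Ico p q).filter fun m => τ < V m).card : ℕ) : ℝ) * τ ≤
        ∑ m ∈ Finset.Ico p q, V m :=
      calc ((((Finset.Ico p q).filter fun m => τ < V m).card : ℕ) : ℝ) * τ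
          = ((Finset.Ico p q).filter fun m => τ < V m).card • τ := (nsmul_eq_mul _ _).symm
        _ ≤ ∑ m ∈ (Finset.Ico p q).filter (fun m => τ < V m), V m :=
            Finset.card_nsmul_le_sum _ _ _ fun m hm => (Finset.mem_filter.1 hm).2.le
        _ ≤ ∑ m ∈ Finset.Ico p q, V m :=
            Finset.sum_le_sum_of_subset_of_nonneg (Finset.filter_subset _ _) fun m _ _ => hV m
    have h1 : ((((Finset.Ico p q).filter fun m => τ < V m).card : ℕ) : ℝ) ≤ O₀ / τ := by
      rw [le_div_iff₀ hτ]; exact hmk.trans (hPB p q hnf)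
    have h2 : (0 : ℝ) ≤ r := Nat.cast_nonneg r
    nlinarith
  · -- split at a fault `f`: `[p, q) = [p, f) ∪ [f, f+1) ∪ [f+1, q)`
    obtain ⟨f, hf⟩ := Finset.nonempty_iff_ne_empty.2 h0
    obtain ⟨hfI, hff⟩ := Finset.mem_filter.1 hf
    obtain ⟨hpf, hfq⟩ := Finset.mem_Ico.1 hfI
    have h23 : Finset.Ico f (f + 1) ∪ Finset.Ico (f + 1) q = Finset.Ico f q :=
      Finset.Ico_union_Ico_eq_Ico (by omega) (by omega)
    have hsplit : Finset.Ico p q = Finset.Ico p f ∪ (Finset.Ico f (f + 1) ∪ Finset.Ico (f + 1) q) := by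
      rw [h23, Finset.Ico_union_Ico_eq_Ico hpf hfq.le]
    have hd1 : Disjoint (Finset.Ico p f) (Finset.Ico f (f + 1) ∪ Finset.Ico (f + 1) q) := by
      rw [h23]
      exact Finset.Ico_disjoint_Ico_consecutive p f q
    have hd2 : Disjoint (Finset.Ico f (f + 1)) (Finset.Ico (f + 1) q) :=
      Finset.Ico_disjoint_Ico_consecutive f (f + 1) q
    -- cardinalities of filters over the three parts add up
    have hadd : ∀ (P : ℤ → Prop) [DecidablePred P],
        ((Finset.Ico p q).filter P).card = ((Finset.Ico p f).filter P).card +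
          (((Finset.Ico f (f + 1)).filter P).card + ((Finset.Ico (f + 1) q).filter P).card) := by
      intro P _
      rw [hsplit, Finset.filter_union, Finset.card_union_of_disjoint (Finset.disjoint_filter_filter hd1),
        Finset.filter_union, Finset.card_union_of_disjoint (Finset.disjoint_filter_filter hd2)]
    -- the middle part has one element, and it is a fault
    have hmid : ((Finset.Ico f (f + 1)).filter fun m => τ < V m).card ≤ 1 := by
      refine (Finset.card_filter_le _ _).trans ?_
      rw [Int.card_Ico]; omega
    have hmidf : 1 ≤ ((Finset.Ico f (f + 1)).filter fun m => fault m).card :=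
      Finset.card_pos.2 ⟨f, Finset.mem_filter.2 ⟨Finset.mem_Ico.2 ⟨le_rfl, by omega⟩, hff⟩⟩
    -- fault counts of the outer parts, induction hypothesis
    have hrr : ((Finset.Ico p f).filter fun m => fault m).card +
        ((Finset.Ico (f + 1) q).filter fun m => fault m).card + 1 ≤ r := by
      have := hadd fun m => fault m
      omega
    have i1 := ih ((Finset.Ico p f).filter fun m => fault m).card (by omega) p f le_rfl
    have i3 := ih ((Finset.Ico (f + 1) q).filter fun m => fault m).card (by omega) (f + 1) q le_rfl
    have hc' : ((((Finset.Ico p q).filter fun m => τ < V m).card : ℕ) : ℝ) ≤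
        ((((Finset.Ico p f).filter fun m => τ < V m).card : ℕ) : ℝ) + 1 +
          ((((Finset.Ico (f + 1) q).filter fun m => τ < V m).card : ℕ) : ℝ) := by
      have hc := hadd fun m => τ < V m
      have : ((Finset.Ico p q).filter fun m => τ < V m).card ≤
          ((Finset.Ico p f).filter fun m => τ < V m).card + 1 +
            ((Finset.Ico (f + 1) q).filter fun m => τ < V m).card := by omega
      exact_mod_cast this
    have hrr' : ((((Finset.Ico p f).filter fun m => fault m).card : ℕ) : ℝ) +
        ((((Finset.Ico (f + 1) q).filter fun m => fault m).card : ℕ) : ℝ) + 1 ≤ r := by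
      exact_mod_cast hrr
    nlinarith

/-! ## The hull-level bad-layer bound -/

/-- **At most `B₀(δ, K)` bad base layers per block (hull level), discharged by the landed stubs of
stmt-11779.**  For every `δ > 0` and `K : ℕ` there is `B₀` such that for every sequence `x` of
Lennard-Jones ground states, every layered set `A(S(a, s, z))` in the hull of `x` (`a ∈ [47/50, 1]`,
`IsHaggSeq s`, increments in the box) and every block `[m₁, m₁ + n)`, every set `B` of base layers of the
block around each of which the heights are NOT `δ`-close to an arithmetic progression on the layers
`|m − m₀| ≤ K` has at most `B₀` elements; explicitly `B₀ = (2K+1)·((F₀+1)·O₀·(K+1)⁸/δ⁴ + F₀)` with the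
constants of `hull_faultCount_le_of_landed` and `hull_sqVariation_le_of_landed`. [folklore] -/
theorem hull_badLayers_le_of_landed :
    ∀ (δ : ℝ), 0 < δ → ∀ (K : ℕ), ∃ B₀ : ℝ,
      ∀ (x : (N : ℕ) → (Fin N → (EuclideanSpace ℝ (Fin 3)))), (∀ N, IsGroundState lennardJones (x N)) →
      ∀ (a : ℝ), 47 / 50 ≤ a → a ≤ 1 →
      ∀ (A : (EuclideanSpace ℝ (Fin 3)) →ₗᵢ[ℝ] (EuclideanSpace ℝ (Fin 3))) (s : ℤ → ℤ) (z : ℤ → ℝ),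
      IsHaggSeq s → (∀ m : ℤ, 39 / 50 * a ≤ z (m + 1) - z m ∧ z (m + 1) - z m ≤ 17 / 20 * a) →
      (let S : Set (EuclideanSpace ℝ (Fin 3)) := {p | ∃ m i j : ℤ, p = A (((i : ℝ) • triangularVec₁ a) +
          ((j : ℝ) • triangularVec₂ a) + ((haggLabel s m : ℝ) • barlowOffset a) + (z m • layerNormal 1))};
        ∀ R ε : ℝ, 0 < ε → ∃ᶠ N in atTop, ∃ t : (EuclideanSpace ℝ (Fin 3)),
          (∀ p ∈ S, ‖p‖ ≤ R → ∃ i : Fin N, dist (x N i + t) p ≤ ε) ∧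
          (∀ i : Fin N, ‖x N i + t‖ ≤ R → ∃ p ∈ S, dist (x N i + t) p ≤ ε)) →
      ∀ (m₁ : ℤ) (n : ℕ) (B : Finset ℤ), B ⊆ Finset.Ico m₁ (m₁ + n) →
        (∀ m₀ ∈ B, ¬ ∃ h : ℝ, ∀ m : ℤ, |(m : ℝ) - m₀| ≤ K → |z m - z m₀ - ((m : ℝ) - m₀) * h| ≤ δ) →
        (B.card : ℝ) ≤ B₀ := by
  classical
  intro δ hδ K
  obtain ⟨F₀, hF⟩ := hull_faultCount_le_of_landed
  obtain ⟨O₀, hO⟩ := hull_sqVariation_le_of_landed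
  -- tolerance on the increment differences and threshold on their squares
  set η : ℝ := δ / ((K : ℝ) + 1) ^ 2 with hη
  have hηpos : 0 < η := by positivity
  set τ : ℝ := η ^ 2 with hτ
  have hτpos : 0 < τ := by positivity
  refine ⟨(2 * K + 1) * ((F₀ + 1) * (O₀ / τ) + F₀), ?_⟩
  intro x hx a ha ha1 A s z hs hz hH m₁ n B hB hBbad
  have hF' := hF x hx a ha ha1 A s z hs hz hH
  have hO' := hO x hx a ha ha1 A s z hs hz hH
  have hO0 : 0 ≤ O₀ := by simpa using hO' 0 0 fun l hl => absurd hl (Nat.not_lt_zero l)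
  have h3 : 0 ≤ O₀ / τ := div_nonneg hO0 hτpos.le
  -- the squared variation of the increments
  set V : ℤ → ℝ := fun m => ((z (m + 1) - z m) - (z (m + 2) - z (m + 1))) ^ 2 with hV
  have hV0 : ∀ m, 0 ≤ V m := fun m => sq_nonneg _
  -- block-local Part B, interval form
  have hPB : ∀ p q : ℤ, (∀ m ∈ Finset.Ico p q, ¬(s (m + 1) ≠ -s m)) →
      ∑ m ∈ Finset.Ico p q, V m ≤ O₀ := by
    intro p q hpq
    rcases le_or_gt q p with hqp | hpq'
    · rw [Finset.Ico_eq_empty (not_lt.2 hqp), Finset.sum_empty]; exact hO0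
    · obtain ⟨k, rfl⟩ : ∃ k : ℕ, q = p + k := ⟨(q - p).toNat, by omega⟩
      rw [clo_sum_Ico_eq_sum_range]
      refine hO' p k fun l hl => ?_
      have := hpq (p + l) (Finset.mem_Ico.2 ⟨by omega, by omega⟩)
      push Not at this
      exact this
  have hcount := sel_count_le (fun m => s (m + 1) ≠ -s m) V hV0 hO0 hτpos hPB
  -- the enlarged block and its fault count
  have hIfault : ((((Finset.Ico (m₁ - K) (m₁ + n + K)).filter fun m => s (m + 1) ≠ -s m).card : ℕ) : ℝ)
      ≤ F₀ := by
    have h1 := hF' (m₁ - K) (n + 2 * K)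
    have e : Finset.Ico (m₁ - (K : ℤ)) (m₁ - K + ((n + 2 * K : ℕ) : ℤ)) =
        Finset.Ico (m₁ - (K : ℤ)) (m₁ + n + K) := by
      congr 1; push_cast; ring
    rw [e] at h1
    rw [Finset.natCast_card_filter]
    refine le_trans (le_of_eq (Finset.sum_congr rfl fun m _ => ?_)) h1
    simp only [ne_eq, ite_not]
  -- positions of large squared variation in the enlarged block
  have hT : ((((Finset.Ico (m₁ - K) (m₁ + n + K)).filter fun m => τ < V m).card : ℕ) : ℝ) ≤
      (F₀ + 1) * (O₀ / τ) + F₀ := by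
    have h1 := hcount (((Finset.Ico (m₁ - K) (m₁ + n + K)).filter fun m => s (m + 1) ≠ -s m).card)
      (m₁ - K) (m₁ + n + K) le_rfl
    nlinarith [h1, hIfault, h3]
  -- every bad base layer is within `K` of such a position
  have hsub : B ⊆ ((Finset.Ico (m₁ - K) (m₁ + n + K)).filter fun m => τ < V m).biUnion
      fun m => Finset.Icc (m - K) (m + K) := by
    intro m₀ hm₀
    obtain ⟨h1, h2⟩ := Finset.mem_Ico.1 (hB hm₀)
    have hbad := hBbad m₀ hm₀
    rw [Finset.mem_biUnion]
    by_contra hcon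
    push Not at hcon
    apply hbad
    have hK0 : (0 : ℝ) ≤ K := Nat.cast_nonneg K
    -- small squared variation on the window, else a large position charges `m₀`
    have hsmall : ∀ m : ℤ, |(m : ℝ) - m₀| ≤ K →
        ((z (m + 1) - z m) - (z (m + 2) - z (m + 1))) ^ 2 ≤ η ^ 2 := by
      intro m hm
      by_contra hlt
      push Not at hlt
      rw [abs_le] at hm
      obtain ⟨hl, hr⟩ := hm
      have hlo : m₀ - (K : ℤ) ≤ m := by
        have : ((m₀ - (K : ℤ) : ℤ) : ℝ) ≤ m := by push_cast; linarith
        exact_mod_cast this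
      have hhi : m ≤ m₀ + (K : ℤ) := by
        have : ((m : ℤ) : ℝ) ≤ ((m₀ + (K : ℤ) : ℤ) : ℝ) := by push_cast; linarith
        exact_mod_cast this
      have hmT : m ∈ (Finset.Ico (m₁ - K) (m₁ + n + K)).filter fun m => τ < V m :=
        Finset.mem_filter.2 ⟨Finset.mem_Ico.2 ⟨by omega, by omega⟩, hlt⟩
      exact hcon m hmT (Finset.mem_Icc.2 ⟨by omega, by omega⟩)
    refine ⟨z (m₀ + 1) - z m₀, fun m hm => ?_⟩
    refine (sel_nearArith_of_sqVar hK0 hηpos.le hsmall m hm).trans ?_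
    rw [hη, ← mul_div_assoc, div_le_iff₀ (by positivity)]
    nlinarith [hδ, hK0]
  -- count
  have hbU : ((((Finset.Ico (m₁ - K) (m₁ + n + K)).filter fun m => τ < V m).biUnion
      fun m => Finset.Icc (m - K) (m + K)).card : ℝ) ≤
      (((Finset.Ico (m₁ - K) (m₁ + n + K)).filter fun m => τ < V m).card : ℝ) * (2 * K + 1) := by
    have := Finset.card_biUnion_le_card_mul ((Finset.Ico (m₁ - K) (m₁ + n + K)).filter fun m => τ < V m)
      (fun m => Finset.Icc (m - (K : ℤ)) (m + K)) (2 * K + 1) fun m _ => by rw [Int.card_Icc]; omega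
    exact_mod_cast this
  calc (B.card : ℝ) ≤ ((((Finset.Ico (m₁ - K) (m₁ + n + K)).filter fun m => τ < V m).biUnion
        fun m => Finset.Icc (m - K) (m + K)).card : ℝ) := by exact_mod_cast Finset.card_le_card hsub
    _ ≤ (((Finset.Ico (m₁ - K) (m₁ + n + K)).filter fun m => τ < V m).card : ℝ) * (2 * K + 1) := hbU
    _ ≤ ((F₀ + 1) * (O₀ / τ) + F₀) * (2 * K + 1) := mul_le_mul_of_nonneg_right hT (by positivity)
    _ = (2 * K + 1) * ((F₀ + 1) * (O₀ / τ) + F₀) := by ring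

/-- **Anchor (registered sub-goal form of `hull_badLayers_le_of_landed`, same statement).**  For every
`δ > 0` and `K`, every layered hull element of a Lennard-Jones ground-state sequence has at most
`B₀(δ, K)` base layers in any block around which the heights are not `δ`-close to an arithmetic
progression on `2K + 1` layers — the hull-level form of the a.e. near-uniform-gap selection
`stub_uniformSpacingSelection`. [folklore] -/
theorem stub_hullBadLayers :
    ∀ (δ : ℝ), 0 < δ → ∀ (K : ℕ), ∃ B₀ : ℝ,
      ∀ (x : (N : ℕ) → (Fin N → (EuclideanSpace ℝ (Fin 3)))), (∀ N, IsGroundState lennardJones (x N)) →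
      ∀ (a : ℝ), 47 / 50 ≤ a → a ≤ 1 →
      ∀ (A : (EuclideanSpace ℝ (Fin 3)) →ₗᵢ[ℝ] (EuclideanSpace ℝ (Fin 3))) (s : ℤ → ℤ) (z : ℤ → ℝ),
      IsHaggSeq s → (∀ m : ℤ, 39 / 50 * a ≤ z (m + 1) - z m ∧ z (m + 1) - z m ≤ 17 / 20 * a) →
      (let S : Set (EuclideanSpace ℝ (Fin 3)) := {p | ∃ m i j : ℤ, p = A (((i : ℝ) • triangularVec₁ a) +
          ((j : ℝ) • triangularVec₂ a) + ((haggLabel s m : ℝ) • barlowOffset a) + (z m • layerNormal 1))};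
        ∀ R ε : ℝ, 0 < ε → ∃ᶠ N in atTop, ∃ t : (EuclideanSpace ℝ (Fin 3)),
          (∀ p ∈ S, ‖p‖ ≤ R → ∃ i : Fin N, dist (x N i + t) p ≤ ε) ∧
          (∀ i : Fin N, ‖x N i + t‖ ≤ R → ∃ p ∈ S, dist (x N i + t) p ≤ ε)) →
      ∀ (m₁ : ℤ) (n : ℕ) (B : Finset ℤ), B ⊆ Finset.Ico m₁ (m₁ + n) →
        (∀ m₀ ∈ B, ¬ ∃ h : ℝ, ∀ m : ℤ, |(m : ℝ) - m₀| ≤ K → |z m - z m₀ - ((m : ℝ) - m₀) * h| ≤ δ) →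
        (B.card : ℝ) ≤ B₀ :=
  hull_badLayers_le_of_landed

end Summit.AtomisticToContinuum.Crystallization.Theorems.SquareWellLayerCakeGapTwelveToBarlow

end
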